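import Summits.MatrixMultiplication.OmegaCensus.STPP222CubeFrom46
import Summits.MatrixMultiplication.OmegaCensus.STPP222CubeBelow46
import Summits.MatrixMultiplication.OmegaCensus.STPPPatternMonotonicity
import Summits.MatrixMultiplication.OmegaCensus.STPP222SqNoneBelow24
import Summits.MatrixMultiplication.OmegaCensus.STPP222CubeNoneZ24
import Summits.MatrixMultiplication.OmegaCensus.STPP222CubeNoneZ25
import Summits.MatrixMultiplication.OmegaCensus.STPP222CubeNoneZ26
import Summits.MatrixMultiplication.OmegaCensus.STPP222CubeNoneZ27
import Summits.MatrixMultiplication.OmegaCensus.STPP222CubeNoneZ28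
import Summits.MatrixMultiplication.OmegaCensus.STPP222CubeNoneZ29
import Summits.MatrixMultiplication.OmegaCensus.STPP222CubeNoneZ30
import Summits.MatrixMultiplication.OmegaCensus.STPP222CubeNoneZ31
import Summits.MatrixMultiplication.OmegaCensus.STPP222CubeNone_2_4_3
import Summits.MatrixMultiplication.OmegaCensus.STPP222CubeNone_2_2_2_3
import Summits.MatrixMultiplication.OmegaCensus.STPP222CubeNone_3_9
import Summits.MatrixMultiplication.OmegaCensus.STPP222CubeNone_3_3_3
import Summits.MatrixMultiplication.OmegaCensus.STPP222CubeNone_2_2_7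

/-!
# ω-census, STPP law `(2,2,2)³`: NO finite abelian group of order `≤ 31` admits it (kernel); `n₃ = 32` exact

HONEST FRAMING (pub-omega census; verbatim): lottery ticket; floor = certified bounds/negative ranges.
Census STRUCTURE bookkeeping (question Q7, row `k = 3` of the threshold functions `n_k`, `N_k`), not progress on `ω`:
three simultaneous `⟨2,2,2⟩` triples yield nothing of interest for matrix multiplication.

This file completes the LOWER HALF of the row `k = 3` IN THE KERNEL:
* `not_exists_isSTPP_222cube_of_card_le` — **no finite abelian group `G` with `Nat.card G ≤ 31` has
  `A B C : Fin 3 → Finset G`, all of cardinality `2`, with `IsSTPP A B C`;**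
* `stpp222Cube_n3_eq_32` — together with the order-`32` witness `exists_isSTPP_222cube_zmod2_pow5` (`(ℤ/2)⁵`,
  `STPP222CubeBelow46.lean`): the least order of a finite abelian group admitting `(2,2,2)³` is exactly `32`.
(The upper threshold `N₃ = 46` is `STPP222CubeFrom46.lean`; orders `32 … 45` are mixed and are not treated here.)

Proof.  `|G| ≤ 23`: the first two of the three triples form a `(2,2,2)²` configuration (the tree's
`exists_isSTPP_222sq_of_222cube`, `STPP222SqSeeds.lean`), excluded by the `k = 2` capstone
`not_exists_isSTPP_222sq_of_card_le` (`STPP222SqNoneBelow24.lean`).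
`24 ≤ |G| ≤ 31`: structure theorem (`AddCommGroup.equiv_directSum_zmod_of_finite`); the multiset `M` of nontrivial
prime-power factors has product `|G| ≤ 31 < 46`, hence is bounded by the capping multiset of `STPP222CubeFrom46.lean`
(`cap_spec`), and a kernel decision (`noneList3_of_capped`) matches it — up to the generic embedding `exists_emb_of_dom`,
which is onto by cardinality — with one of the fourteen abelian groups of order `24 … 31`:
`ℤ/24, ℤ/2×ℤ/12, (ℤ/2)²×ℤ/6, ℤ/25, (ℤ/5)², ℤ/26, ℤ/27, ℤ/3×ℤ/9, (ℤ/3)³, ℤ/28, (ℤ/2)²×ℤ/7, ℤ/29, ℤ/30, ℤ/31`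
(as `SeedType` lists `[8,3], [2,4,3], [2,2,2,3], [25], [5,5], [2,13], [27], [3,9], [3,3,3], [4,7], [2,2,7], [29], [2,3,5],
[31]`; cyclic ones read through the Chinese remainder theorem).  Thirteen of them are excluded by their own kernel theorem
(files `STPP222CubeNoneZ*.lean`, cyclic, and `STPP222CubeNone_*.lean`, products — complete mask searches decided by
`decide +kernel` and reflected through CKSU Def. 5.1, see `STPP222CubeEngine/Search/Clauses/Valid/Reflect/Cover(Rot).lean`,
ENG2 gens 17–19); `(ℤ/5)²` is free: it admits no `(2,2,2)²` (`STPP222SqNeg.not_exists_isSTPP_222sq_5_5`, seat pub-omega-stpp-1).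

References: H. Cohn, R. Kleinberg, B. Szegedy, C. Umans, FOCS 2005 (arXiv:math/0511460), Def. 5.1.
Record: pub-omega HOME `pub-omega-eng2/results/c4red/K2-THRESHOLD-eng2.md` §NEG3 (ENG2 gens 18–19, 2026-08-23/24).
-/

open Literature.Computability.AlgebraicComplexity Finset

namespace Summit.MatrixMultiplication.OmegaCensus

/-! ## 1. The fourteen groups of order `24 … 31`, as lists of prime-power moduli, and the combinatorial core -/

/-- The abelian groups of order `24 … 31`, as lists of prime-power moduli (product type `SeedType`; the coprime lists
`[8,3], [2,13], [4,7], [2,3,5]` are the cyclic groups `ℤ/24, ℤ/26, ℤ/28, ℤ/30`, read through the Chinese remainder theorem). -/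
def noneLists3 : List (List ℕ) :=
  [[8, 3], [2, 4, 3], [2, 2, 2, 3], [25], [5, 5], [2, 13], [27], [3, 9], [3, 3, 3], [4, 7], [2, 2, 7], [29],
   [2, 3, 5], [31]]

/-- Combinatorial core, modulus `E = 1` alone (kernel decision over the sub-multisets of `C_1`). -/
theorem noneList3_of_capped_1 : ∀ M ∈ subMS (capList 1), 24 ≤ M.prod → M.prod ≤ 31 →
    ∃ s ∈ noneLists3, dom s M = true ∧ s.prod = M.prod := by decide +kernel

/-- Combinatorial core, modulus `E = 2` alone (kernel decision over the sub-multisets of `C_2`). -/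
theorem noneList3_of_capped_2 : ∀ M ∈ subMS (capList 2), 24 ≤ M.prod → M.prod ≤ 31 →
    ∃ s ∈ noneLists3, dom s M = true ∧ s.prod = M.prod := by decide +kernel

/-- Combinatorial core, modulus `E = 3` alone (kernel decision over the sub-multisets of `C_3`). -/
theorem noneList3_of_capped_3 : ∀ M ∈ subMS (capList 3), 24 ≤ M.prod → M.prod ≤ 31 →
    ∃ s ∈ noneLists3, dom s M = true ∧ s.prod = M.prod := by decide +kernel

/-- Combinatorial core, modulus `E = 4` alone (kernel decision over the sub-multisets of `C_4`). -/
theorem noneList3_of_capped_4 : ∀ M ∈ subMS (capList 4), 24 ≤ M.prod → M.prod ≤ 31 →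
    ∃ s ∈ noneLists3, dom s M = true ∧ s.prod = M.prod := by decide +kernel

/-- Combinatorial core, modulus `E = 5` alone (kernel decision over the sub-multisets of `C_5`). -/
theorem noneList3_of_capped_5 : ∀ M ∈ subMS (capList 5), 24 ≤ M.prod → M.prod ≤ 31 →
    ∃ s ∈ noneLists3, dom s M = true ∧ s.prod = M.prod := by decide +kernel

/-- Combinatorial core, modulus `E = 6` alone (kernel decision over the sub-multisets of `C_6`). -/
theorem noneList3_of_capped_6 : ∀ M ∈ subMS (capList 6), 24 ≤ M.prod → M.prod ≤ 31 →
    ∃ s ∈ noneLists3, dom s M = true ∧ s.prod = M.prod := by decide +kernel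

/-- Combinatorial core, modulus `E = 7` alone (kernel decision over the sub-multisets of `C_7`). -/
theorem noneList3_of_capped_7 : ∀ M ∈ subMS (capList 7), 24 ≤ M.prod → M.prod ≤ 31 →
    ∃ s ∈ noneLists3, dom s M = true ∧ s.prod = M.prod := by decide +kernel

/-- Combinatorial core, modulus `E = 8` alone (kernel decision over the sub-multisets of `C_8`). -/
theorem noneList3_of_capped_8 : ∀ M ∈ subMS (capList 8), 24 ≤ M.prod → M.prod ≤ 31 →
    ∃ s ∈ noneLists3, dom s M = true ∧ s.prod = M.prod := by decide +kernel

/-- Combinatorial core, modulus `E = 9` alone (kernel decision over the sub-multisets of `C_9`). -/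
theorem noneList3_of_capped_9 : ∀ M ∈ subMS (capList 9), 24 ≤ M.prod → M.prod ≤ 31 →
    ∃ s ∈ noneLists3, dom s M = true ∧ s.prod = M.prod := by decide +kernel

/-- Combinatorial core, modulus `E = 10` alone (kernel decision over the sub-multisets of `C_10`). -/
theorem noneList3_of_capped_10 : ∀ M ∈ subMS (capList 10), 24 ≤ M.prod → M.prod ≤ 31 →
    ∃ s ∈ noneLists3, dom s M = true ∧ s.prod = M.prod := by decide +kernel

/-- Combinatorial core, modulus `E = 11` alone (kernel decision over the sub-multisets of `C_11`). -/
theorem noneList3_of_capped_11 : ∀ M ∈ subMS (capList 11), 24 ≤ M.prod → M.prod ≤ 31 →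
    ∃ s ∈ noneLists3, dom s M = true ∧ s.prod = M.prod := by decide +kernel

/-- Combinatorial core, modulus `E = 12` alone (kernel decision over the sub-multisets of `C_12`). -/
theorem noneList3_of_capped_12 : ∀ M ∈ subMS (capList 12), 24 ≤ M.prod → M.prod ≤ 31 →
    ∃ s ∈ noneLists3, dom s M = true ∧ s.prod = M.prod := by decide +kernel

/-- Combinatorial core, modulus `E = 13` alone (kernel decision over the sub-multisets of `C_13`). -/
theorem noneList3_of_capped_13 : ∀ M ∈ subMS (capList 13), 24 ≤ M.prod → M.prod ≤ 31 →
    ∃ s ∈ noneLists3, dom s M = true ∧ s.prod = M.prod := by decide +kernel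

/-- Combinatorial core, modulus `E = 14` alone (kernel decision over the sub-multisets of `C_14`). -/
theorem noneList3_of_capped_14 : ∀ M ∈ subMS (capList 14), 24 ≤ M.prod → M.prod ≤ 31 →
    ∃ s ∈ noneLists3, dom s M = true ∧ s.prod = M.prod := by decide +kernel

/-- Combinatorial core, modulus `E = 15` alone (kernel decision over the sub-multisets of `C_15`). -/
theorem noneList3_of_capped_15 : ∀ M ∈ subMS (capList 15), 24 ≤ M.prod → M.prod ≤ 31 →
    ∃ s ∈ noneLists3, dom s M = true ∧ s.prod = M.prod := by decide +kernel

/-- Combinatorial core, modulus `E = 16` alone (kernel decision over the sub-multisets of `C_16`). -/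
theorem noneList3_of_capped_16 : ∀ M ∈ subMS (capList 16), 24 ≤ M.prod → M.prod ≤ 31 →
    ∃ s ∈ noneLists3, dom s M = true ∧ s.prod = M.prod := by decide +kernel

/-- Combinatorial core, modulus `E = 17` alone (kernel decision over the sub-multisets of `C_17`). -/
theorem noneList3_of_capped_17 : ∀ M ∈ subMS (capList 17), 24 ≤ M.prod → M.prod ≤ 31 →
    ∃ s ∈ noneLists3, dom s M = true ∧ s.prod = M.prod := by decide +kernel

/-- Combinatorial core, modulus `E = 18` alone (kernel decision over the sub-multisets of `C_18`). -/
theorem noneList3_of_capped_18 : ∀ M ∈ subMS (capList 18), 24 ≤ M.prod → M.prod ≤ 31 →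
    ∃ s ∈ noneLists3, dom s M = true ∧ s.prod = M.prod := by decide +kernel

/-- Combinatorial core, modulus `E = 19` alone (kernel decision over the sub-multisets of `C_19`). -/
theorem noneList3_of_capped_19 : ∀ M ∈ subMS (capList 19), 24 ≤ M.prod → M.prod ≤ 31 →
    ∃ s ∈ noneLists3, dom s M = true ∧ s.prod = M.prod := by decide +kernel

/-- Combinatorial core, modulus `E = 20` alone (kernel decision over the sub-multisets of `C_20`). -/
theorem noneList3_of_capped_20 : ∀ M ∈ subMS (capList 20), 24 ≤ M.prod → M.prod ≤ 31 →
    ∃ s ∈ noneLists3, dom s M = true ∧ s.prod = M.prod := by decide +kernel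

/-- Combinatorial core, modulus `E = 21` alone (kernel decision over the sub-multisets of `C_21`). -/
theorem noneList3_of_capped_21 : ∀ M ∈ subMS (capList 21), 24 ≤ M.prod → M.prod ≤ 31 →
    ∃ s ∈ noneLists3, dom s M = true ∧ s.prod = M.prod := by decide +kernel

/-- Combinatorial core, modulus `E = 22` alone (kernel decision over the sub-multisets of `C_22`). -/
theorem noneList3_of_capped_22 : ∀ M ∈ subMS (capList 22), 24 ≤ M.prod → M.prod ≤ 31 →
    ∃ s ∈ noneLists3, dom s M = true ∧ s.prod = M.prod := by decide +kernel

/-- Combinatorial core, modulus `E = 23` alone (kernel decision over the sub-multisets of `C_23`). -/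
theorem noneList3_of_capped_23 : ∀ M ∈ subMS (capList 23), 24 ≤ M.prod → M.prod ≤ 31 →
    ∃ s ∈ noneLists3, dom s M = true ∧ s.prod = M.prod := by decide +kernel

/-- Combinatorial core, modulus `E = 24` alone (kernel decision over the sub-multisets of `C_24`). -/
theorem noneList3_of_capped_24 : ∀ M ∈ subMS (capList 24), 24 ≤ M.prod → M.prod ≤ 31 →
    ∃ s ∈ noneLists3, dom s M = true ∧ s.prod = M.prod := by decide +kernel

/-- Combinatorial core, modulus `E = 25` alone (kernel decision over the sub-multisets of `C_25`). -/
theorem noneList3_of_capped_25 : ∀ M ∈ subMS (capList 25), 24 ≤ M.prod → M.prod ≤ 31 →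
    ∃ s ∈ noneLists3, dom s M = true ∧ s.prod = M.prod := by decide +kernel

/-- Combinatorial core, modulus `E = 26` alone (kernel decision over the sub-multisets of `C_26`). -/
theorem noneList3_of_capped_26 : ∀ M ∈ subMS (capList 26), 24 ≤ M.prod → M.prod ≤ 31 →
    ∃ s ∈ noneLists3, dom s M = true ∧ s.prod = M.prod := by decide +kernel

/-- Combinatorial core, modulus `E = 27` alone (kernel decision over the sub-multisets of `C_27`). -/
theorem noneList3_of_capped_27 : ∀ M ∈ subMS (capList 27), 24 ≤ M.prod → M.prod ≤ 31 →
    ∃ s ∈ noneLists3, dom s M = true ∧ s.prod = M.prod := by decide +kernel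

/-- Combinatorial core, modulus `E = 28` alone (kernel decision over the sub-multisets of `C_28`). -/
theorem noneList3_of_capped_28 : ∀ M ∈ subMS (capList 28), 24 ≤ M.prod → M.prod ≤ 31 →
    ∃ s ∈ noneLists3, dom s M = true ∧ s.prod = M.prod := by decide +kernel

/-- Combinatorial core, modulus `E = 29` alone (kernel decision over the sub-multisets of `C_29`). -/
theorem noneList3_of_capped_29 : ∀ M ∈ subMS (capList 29), 24 ≤ M.prod → M.prod ≤ 31 →
    ∃ s ∈ noneLists3, dom s M = true ∧ s.prod = M.prod := by decide +kernel

/-- Combinatorial core, modulus `E = 30` alone (kernel decision over the sub-multisets of `C_30`). -/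
theorem noneList3_of_capped_30 : ∀ M ∈ subMS (capList 30), 24 ≤ M.prod → M.prod ≤ 31 →
    ∃ s ∈ noneLists3, dom s M = true ∧ s.prod = M.prod := by decide +kernel

/-- Combinatorial core, modulus `E = 31` alone (kernel decision over the sub-multisets of `C_31`). -/
theorem noneList3_of_capped_31 : ∀ M ∈ subMS (capList 31), 24 ≤ M.prod → M.prod ≤ 31 →
    ∃ s ∈ noneLists3, dom s M = true ∧ s.prod = M.prod := by decide +kernel

/-- COMBINATORIAL CORE (kernel decision, assembled from the 31 per-modulus pieces — one small `decide +kernel` each, so no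
single declaration enumerates more than a few hundred multisets): for every modulus `1 ≤ E ≤ 31`, every sub-multiset of the
capping multiset `C_E` of `STPP222CubeFrom46.lean` with product in `[24, 31]` dominates, with EQUAL product, one of the
fourteen lists. -/
theorem noneList3_of_capped : ∀ E ∈ List.range' 1 31, ∀ M ∈ subMS (capList E), 24 ≤ M.prod → M.prod ≤ 31 →
    ∃ s ∈ noneLists3, dom s M = true ∧ s.prod = M.prod :=
  List.forall_mem_cons.2 ⟨noneList3_of_capped_1,
    List.forall_mem_cons.2 ⟨noneList3_of_capped_2,
    List.forall_mem_cons.2 ⟨noneList3_of_capped_3,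
    List.forall_mem_cons.2 ⟨noneList3_of_capped_4,
    List.forall_mem_cons.2 ⟨noneList3_of_capped_5,
    List.forall_mem_cons.2 ⟨noneList3_of_capped_6,
    List.forall_mem_cons.2 ⟨noneList3_of_capped_7,
    List.forall_mem_cons.2 ⟨noneList3_of_capped_8,
    List.forall_mem_cons.2 ⟨noneList3_of_capped_9,
    List.forall_mem_cons.2 ⟨noneList3_of_capped_10,
    List.forall_mem_cons.2 ⟨noneList3_of_capped_11,
    List.forall_mem_cons.2 ⟨noneList3_of_capped_12,
    List.forall_mem_cons.2 ⟨noneList3_of_capped_13,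
    List.forall_mem_cons.2 ⟨noneList3_of_capped_14,
    List.forall_mem_cons.2 ⟨noneList3_of_capped_15,
    List.forall_mem_cons.2 ⟨noneList3_of_capped_16,
    List.forall_mem_cons.2 ⟨noneList3_of_capped_17,
    List.forall_mem_cons.2 ⟨noneList3_of_capped_18,
    List.forall_mem_cons.2 ⟨noneList3_of_capped_19,
    List.forall_mem_cons.2 ⟨noneList3_of_capped_20,
    List.forall_mem_cons.2 ⟨noneList3_of_capped_21,
    List.forall_mem_cons.2 ⟨noneList3_of_capped_22,
    List.forall_mem_cons.2 ⟨noneList3_of_capped_23,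
    List.forall_mem_cons.2 ⟨noneList3_of_capped_24,
    List.forall_mem_cons.2 ⟨noneList3_of_capped_25,
    List.forall_mem_cons.2 ⟨noneList3_of_capped_26,
    List.forall_mem_cons.2 ⟨noneList3_of_capped_27,
    List.forall_mem_cons.2 ⟨noneList3_of_capped_28,
    List.forall_mem_cons.2 ⟨noneList3_of_capped_29,
    List.forall_mem_cons.2 ⟨noneList3_of_capped_30,
    List.forall_mem_cons.2 ⟨noneList3_of_capped_31,
    fun _ h => nomatch h⟩⟩⟩⟩⟩⟩⟩⟩⟩⟩⟩⟩⟩⟩⟩⟩⟩⟩⟩⟩⟩⟩⟩⟩⟩⟩⟩⟩⟩⟩⟩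

/-- Elements of `ppList` are at least `2`. -/
theorem two_le_of_mem_ppList {a : ℕ} (h : a ∈ ppList) : 2 ≤ a := by
  simp only [ppList, List.mem_cons, List.mem_nil_iff, or_false] at h
  omega

/-- A multiset of prime powers from `ppList`, all dividing `1 ≤ E ≤ 45`, with product `≤ 45`, is bounded by the
capping multiset `C_E` of `STPP222CubeFrom46.lean` (its multiplicities are below the caps, since
`a ^ count ≤ 45 < 46 ≤ a ^ cap`). -/
theorem le_capMS_of_prod_le45 {M : Multiset ℕ} {E : ℕ} (hEI : E ∈ List.range' 1 45) (hpp : ∀ a ∈ M, a ∈ ppList)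
    (hdvd : ∀ a ∈ M, a ∣ E) (h45 : M.prod ≤ 45) : M ≤ capMS (capList E) := by
  rw [Multiset.le_iff_count]
  intro a
  by_cases ha : a ∈ M
  · have h2 := two_le_of_mem_ppList (hpp a ha)
    have hle : a ^ Multiset.count a M ≤ 45 :=
      le_trans (pow_count_le_prod (fun x hx => le_trans (by norm_num) (two_le_of_mem_ppList (hpp x hx))) a) h45
    have hcap := cap_spec E hEI a (hpp a ha) (hdvd a ha)
    have hlt : a ^ Multiset.count a M < a ^ Multiset.count a (capMS (capList E)) := by omega
    exact le_of_lt ((Nat.pow_lt_pow_iff_right (by omega)).1 hlt)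
  · simp [Multiset.count_eq_zero_of_notMem ha]

/-! ## 2. The fourteen exclusions, read on `SeedType` -/

/-- A `(2,2,2)³` configuration in `SeedType [m, n] = ℤ/m × ℤ/n` with `m, n` coprime gives one in `ℤ/(m n)` (Chinese
remainder theorem + transport along the inverse isomorphism). [cite: CohnKleinbergSzegedyUmans2005, Def. 5.1] -/
theorem exists_isSTPP_222cube_zmod_mul_of_seedPair {m n : ℕ} (h : m.Coprime n)
    (hex : ∃ A B C : Fin 3 → Finset (SeedType [m, n]), IsSTPP A B C ∧
      ∀ i, (A i).card = 2 ∧ (B i).card = 2 ∧ (C i).card = 2) :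
    ∃ A B C : Fin 3 → Finset (ZMod (m * n)), IsSTPP A B C ∧ ∀ i, (A i).card = 2 ∧ (B i).card = 2 ∧ (C i).card = 2 :=
  exists_isSTPP_222cube_of_injective (ZMod.chineseRemainder h).symm.toAddEquiv.toAddMonoidHom
    (ZMod.chineseRemainder h).symm.injective hex

/-- A `(2,2,2)³` configuration in `SeedType [a, m, n] = ℤ/a × (ℤ/m × ℤ/n)` with `m, n` coprime and `a` coprime to `m n`
gives one in `ℤ/(a (m n))` (two Chinese-remainder steps). [cite: CohnKleinbergSzegedyUmans2005, Def. 5.1] -/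
theorem exists_isSTPP_222cube_zmod_mul3_of_seedTriple {a m n : ℕ} (hmn : m.Coprime n) (ha : a.Coprime (m * n))
    (hex : ∃ A B C : Fin 3 → Finset (SeedType [a, m, n]), IsSTPP A B C ∧
      ∀ i, (A i).card = 2 ∧ (B i).card = 2 ∧ (C i).card = 2) :
    ∃ A B C : Fin 3 → Finset (ZMod (a * (m * n))), IsSTPP A B C ∧
      ∀ i, (A i).card = 2 ∧ (B i).card = 2 ∧ (C i).card = 2 :=
  let e : ZMod a × (ZMod m × ZMod n) ≃+ ZMod (a * (m * n)) :=
    (AddEquiv.prodCongr (AddEquiv.refl (ZMod a)) (ZMod.chineseRemainder hmn).symm.toAddEquiv).trans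
      (ZMod.chineseRemainder ha).symm.toAddEquiv
  exists_isSTPP_222cube_of_injective e.toAddMonoidHom e.injective hex

/-- Each of the fourteen listed groups admits no `(2,2,2)³` configuration (thirteen kernel searches, read on `SeedType`,
cyclic ones through the Chinese remainder theorem; `(ℤ/5)²` through its `(2,2,2)²` exclusion).
[cite: CohnKleinbergSzegedyUmans2005, Def. 5.1] -/
theorem not_exists_isSTPP_222cube_of_mem_noneLists3 : ∀ s ∈ noneLists3, ¬ ∃ A B C : Fin 3 → Finset (SeedType s),
    IsSTPP A B C ∧ ∀ i, (A i).card = 2 ∧ (B i).card = 2 ∧ (C i).card = 2 := by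
  intro s hs
  simp only [noneLists3, List.mem_cons, List.mem_nil_iff, or_false] at hs
  rcases hs with rfl | rfl | rfl | rfl | rfl | rfl | rfl | rfl | rfl | rfl | rfl | rfl | rfl | rfl
  · exact fun h => not_exists_isSTPP_222cube_zmod24 (exists_isSTPP_222cube_zmod_mul_of_seedPair (by norm_num) h)
  · exact not_exists_isSTPP_222cube_2_4_3
  · exact not_exists_isSTPP_222cube_2_2_2_3
  · exact not_exists_isSTPP_222cube_zmod25
  · exact fun h => STPP222SqNeg.not_exists_isSTPP_222sq_5_5 (exists_isSTPP_222sq_of_222cube h)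
  · exact fun h => not_exists_isSTPP_222cube_zmod26 (exists_isSTPP_222cube_zmod_mul_of_seedPair (by norm_num) h)
  · exact not_exists_isSTPP_222cube_zmod27
  · exact not_exists_isSTPP_222cube_3_9
  · exact not_exists_isSTPP_222cube_3_3_3
  · exact fun h => not_exists_isSTPP_222cube_zmod28 (exists_isSTPP_222cube_zmod_mul_of_seedPair (by norm_num) h)
  · exact not_exists_isSTPP_222cube_2_2_7
  · exact not_exists_isSTPP_222cube_zmod29
  · exact fun h => not_exists_isSTPP_222cube_zmod30
      (exists_isSTPP_222cube_zmod_mul3_of_seedTriple (by norm_num) (by norm_num) h)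
  · exact not_exists_isSTPP_222cube_zmod31

/-! ## 3. Assembly -/

/-- Transfer of an exclusion along an injective additive map between finite groups of equal cardinality (then onto;
transport along the inverse). [cite: CohnKleinbergSzegedyUmans2005, Def. 5.1] -/
theorem not_exists_isSTPP_222cube_of_card_eq {T P : Type} [AddCommGroup T] [AddCommGroup P] [Finite P] (φ : T →+ P)
    (hφ : Function.Injective φ) (hcard : Nat.card T = Nat.card P)
    (hT : ¬ ∃ A B C : Fin 3 → Finset T, IsSTPP A B C ∧ ∀ i, (A i).card = 2 ∧ (B i).card = 2 ∧ (C i).card = 2) :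
    ¬ ∃ A B C : Fin 3 → Finset P, IsSTPP A B C ∧ ∀ i, (A i).card = 2 ∧ (B i).card = 2 ∧ (C i).card = 2 := by
  intro hP
  have hbij : Function.Bijective φ := hφ.bijective_of_nat_card_le (le_of_eq hcard.symm)
  let e : T ≃+ P := AddEquiv.ofBijective φ hbij
  exact hT (exists_isSTPP_222cube_of_injective e.symm.toAddMonoidHom e.symm.injective hP)

/-- **The product case.** `Π i, ℤ/(pᵢ^{eᵢ})` (primes `pᵢ`, finitely many `i`) admits NO `(2,2,2)³` configuration when every
`pᵢ^{eᵢ}` divides some `1 ≤ E ≤ 31` and `24 ≤ ∏ pᵢ^{eᵢ} ≤ 31`. [cite: CohnKleinbergSzegedyUmans2005, Def. 5.1] -/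
theorem not_exists_isSTPP_222cube_pi {ι : Type} [Fintype ι] [DecidableEq ι] (p e : ι → ℕ) (hp : ∀ i, (p i).Prime)
    {E : ℕ} (hE1 : 1 ≤ E) (hE31 : E ≤ 31) (hdvd : ∀ i, p i ^ e i ∣ E) (h24 : 24 ≤ ∏ i, p i ^ e i)
    (h31 : ∏ i, p i ^ e i ≤ 31) :
    ¬ ∃ A B C : Fin 3 → Finset (Π i, ZMod (p i ^ e i)), IsSTPP A B C ∧
      ∀ i, (A i).card = 2 ∧ (B i).card = 2 ∧ (C i).card = 2 := by
  have hq0 : ∀ i, p i ^ e i ≠ 0 := fun i => pow_ne_zero _ (hp i).ne_zero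
  haveI : ∀ i, NeZero (p i ^ e i) := fun i => ⟨hq0 i⟩
  set M : Multiset ℕ := (Finset.univ.filter fun i => 0 < e i).val.map fun i => p i ^ e i with hM
  have hprodeq : M.prod = ∏ i, p i ^ e i := by
    rw [hM, ← Finset.prod_eq_multiset_prod]
    exact Finset.prod_filter_of_ne fun i _ hi => Nat.pos_of_ne_zero fun h0 => hi (by rw [h0, pow_zero])
  have hmem : ∀ a ∈ M, a ∈ ppList ∧ a ∣ E := by
    intro a ha
    obtain ⟨i, hi, rfl⟩ := Multiset.mem_map.1 ha
    have hi' : 0 < e i := (Finset.mem_filter.1 hi).2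
    exact ⟨pow_mem_ppList (hp i) hi' (le_trans (Nat.le_of_dvd (by omega) (hdvd i)) (by omega)), hdvd i⟩
  have hEI : E ∈ List.range' 1 31 := List.mem_range'_1.2 ⟨hE1, by omega⟩
  have hEI45 : E ∈ List.range' 1 45 := List.mem_range'_1.2 ⟨hE1, by omega⟩
  have hle : M ≤ capMS (capList E) :=
    le_capMS_of_prod_le45 hEI45 (fun a ha => (hmem a ha).1) (fun a ha => (hmem a ha).2) (by rw [hprodeq]; omega)
  obtain ⟨s, hs, hD, hsprod⟩ := noneList3_of_capped E hEI M (mem_subMS_of_le _ _ hle) (by rw [hprodeq]; exact h24)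
    (by rw [hprodeq]; exact h31)
  obtain ⟨φ, hφ, -⟩ := exists_emb_of_dom (fun i => p i ^ e i) hq0 s _ hD
  have hcard : Nat.card (SeedType s) = Nat.card (Π i, ZMod (p i ^ e i)) := by
    rw [card_seedType, hsprod, hprodeq, Nat.card_pi]
    simp
  exact not_exists_isSTPP_222cube_of_card_eq φ hφ hcard (not_exists_isSTPP_222cube_of_mem_noneLists3 s hs)

/-- **No finite abelian group of order `≤ 31` admits three simultaneous-TPP triples of 2-subsets** (CKSU 2005 Def. 5.1,
tree form `IsSTPP`; the pattern `(2,2,2)³`) — the lower half of the census row `k = 3`: `n₃ = 32` exactly (witness of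
order `32`: `exists_isSTPP_222cube_zmod2_pow5`).  Order `≤ 23`: the `k = 2` capstone; order `24 … 31`: structure theorem
+ the thirteen kernel searches + `(ℤ/5)²`.  No `ω` bound follows. [cite: CohnKleinbergSzegedyUmans2005, Def. 5.1] -/
theorem not_exists_isSTPP_222cube_of_card_le {G : Type*} [AddCommGroup G] [Finite G] (hG : Nat.card G ≤ 31) :
    ¬ ∃ A B C : Fin 3 → Finset G, IsSTPP A B C ∧ ∀ i, (A i).card = 2 ∧ (B i).card = 2 ∧ (C i).card = 2 := by
  classical
  intro hex
  have h24 : 24 ≤ Nat.card G := by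
    by_contra hlt
    exact not_exists_isSTPP_222sq_of_card_le (G := G) (by omega) (exists_isSTPP_222sq_of_222cube hex)
  obtain ⟨A, B, C, hS, hc⟩ := hex
  obtain ⟨ι, _, p, hp, e, ⟨g⟩⟩ := AddCommGroup.equiv_directSum_zmod_of_finite G
  let f : G ≃+ (Π i, ZMod (p i ^ e i)) :=
    g.trans (DirectSum.linearEquivFunOnFintype ℕ ι (fun i => ZMod (p i ^ e i))).toAddEquiv
  have hE1 : 1 ≤ AddMonoid.exponent G := Nat.pos_of_ne_zero AddMonoid.exponent_ne_zero_of_finite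
  have hEle : AddMonoid.exponent G ≤ 31 :=
    le_trans (Nat.le_of_dvd Nat.card_pos AddGroup.exponent_dvd_nat_card) hG
  have hdvd : ∀ i, p i ^ e i ∣ AddMonoid.exponent G := fun i => by
    have hinj : Function.Injective (AddMonoidHom.single (fun j => ZMod (p j ^ e j)) i) :=
      Pi.single_injective (M := fun j => ZMod (p j ^ e j)) i
    have h1 : addOrderOf (f.symm (AddMonoidHom.single (fun j => ZMod (p j ^ e j)) i 1)) = p i ^ e i := by
      rw [AddEquiv.addOrderOf_eq, addOrderOf_injective _ hinj, ZMod.addOrderOf_one]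
    rw [← h1]
    exact AddMonoid.addOrder_dvd_exponent _
  have hcardeq : Nat.card G = ∏ i, p i ^ e i := by
    rw [Nat.card_congr f.toEquiv, Nat.card_pi]
    simp [Nat.card_zmod]
  have h := not_exists_isSTPP_222cube_pi p e hp hE1 hEle hdvd (by rw [← hcardeq]; exact h24)
    (by rw [← hcardeq]; exact hG)
  exact h (exists_isSTPP_222cube_of_injective f.toAddMonoidHom f.injective ⟨A, B, C, hS, hc⟩)

/-- **Census row `k = 3`, lower threshold (kernel both ways): `n₃ = 32`.**  No finite abelian group of order `≤ 31`
admits `(2,2,2)³`, and `(ℤ/2)⁵` (order `32`) does. [cite: CohnKleinbergSzegedyUmans2005, Def. 5.1] -/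
theorem stpp222Cube_n3_eq_32 :
    (∀ (G : Type) [AddCommGroup G] [Finite G], Nat.card G ≤ 31 →
      ¬ ∃ A B C : Fin 3 → Finset G, IsSTPP A B C ∧ ∀ i, (A i).card = 2 ∧ (B i).card = 2 ∧ (C i).card = 2) ∧
    ∃ A B C : Fin 3 → Finset (ZMod 2 × ZMod 2 × ZMod 2 × ZMod 2 × ZMod 2),
      IsSTPP A B C ∧ ∀ i, (A i).card = 2 ∧ (B i).card = 2 ∧ (C i).card = 2 :=
  ⟨fun _ _ _ hG => not_exists_isSTPP_222cube_of_card_le hG, exists_isSTPP_222cube_zmod2_pow5⟩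

end Summit.MatrixMultiplication.OmegaCensus
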